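import Summits.Parity.BatemanHorn.Theorems.SoloInformedLogPowerCut
import Literature.NumberTheory.Sieve.PolynomialValuesSieveSequence
import Literature.NumberTheory.Sieve.PolynomialCongruencesMeanValues
import Literature.NumberTheory.Sieve.BatemanHornProofs

/-!
# SoloInformedGeneralPolynomialSplit — for EVERY one-polynomial Bateman–Horn system `g`, `ψ_g(x) ~ C(g)·x` is equivalent to Möbius–log cancellation over the large divisors of the values `g(n)`

Solo unit `solo-Parity-informed` (ideation tier, informed mode), session 11; `PLAN.md` §16.4(b)/§18.4(a), CLAIMS C48.

`SoloInformedLogPowerCut` / `SoloInformedConjEIffLargeDivisors` located Hardy–Littlewood's Conjecture E (the instance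
`g = X² + 1` of the conjunct `BatemanHorn`) in one line: `∑_{n ≤ x} ∑_{d ∣ n²+1, d > y(x)} μ(d) log d = o(x)` for one /
every admissible cut `y → ∞`, `y log y = o(x)`.  Nothing in that argument is special to `X² + 1`.  This file proves the
same localisation for an ARBITRARY one-polynomial Bateman–Horn system `![g]` (`g ∈ ℤ[X]` irreducible, positive leading
coefficient, no fixed prime divisor), at the `ψ`-level, with `N_g(n) := |g(n)|`:

  `ψ_g(x) := ∑_{1 ≤ n ≤ x} Λ(|g(n)|)`,   `T_g(x; y) := ∑_{1 ≤ n ≤ x} ∑_{d ∣ |g(n)|, d > y} μ(d) log d`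
  (inner sum written over the cofactor `e = |g(n)|/d`),  `ρ_g(d) = #{ν mod d : g(ν) ≡ 0}` = `polyRootCountMod ![g] d`,
  `C(g) = batemanHornConst ![g] = ∏_p (1 - 1/p)⁻¹ (1 - ρ_g(p)/p)`.

* `abs_card_filter_dvd_eval_sub_le` — `|#{1 ≤ n ≤ x : d ∣ g(n)} - x ρ_g(d)/d| ≤ ρ_g(d)` (`d ≥ 1`; each root class
  mod `d` meets `[1, x]` in `x/d + O(1)` points — the tree's `card_filter_dvd_eval_eq_sum`,
  `abs_card_Ioc_filter_modEq_sub_le`);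
* `sum_vonMangoldt_polyVal_eq_split` — `Λ = -(μ · log) ∗ 1` split at divisor size `D` and summed over `n ≤ x`:
  `ψ_g(x) = -∑_{d ≤ D} μ(d) log d · #{n ≤ x : d ∣ g(n)} - T_g(x; D)` (for `g` without natural roots, automatic when
  `deg g ≥ 2`: an integer root would give a factor `X - C n` with a unit cofactor);
* `polyMainError_isLittleO_of_cut` — `x · (M_g(y) - C(g)) - ∑_{d ≤ y} μ(d) log d · rem_g(x; d) = o(x)` for every
  admissible cut, from the tree's PROVED `(R1)_g` (`tendsto_neg_sum_moebius_rootCount_log_div`: Landau 1903 for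
  `ℚ[X]/(g)`) and the first moment `∑_{m ≤ y} ρ_g(m) ≤ C y` (`exists_sum_rootCount_le`, Hall–Tenenbaum Thm 01);
* `isEquivalent_sum_vonMangoldt_polyVal_iff_largeDivisorSum_isLittleO_of_cut` — for every admissible cut,
      `ψ_g(x) ~ C(g) x   ⟺   T_g(x; y(x)) = o(x)`;
  specialised to `y = ⌊x^{1-ε}⌋` (`0 < ε < 1`) and `y = ⌊x/(log x)^A⌋` (`A > 1`).

So for the whole one-polynomial sub-family of the conjunct, the `ψ`-form of Bateman–Horn lives in the divisors
`d > x^{1-ε}` (indeed `d > x/(log x)^{1+η}`) of the numbers `|g(n)| ≍ x^{deg g}`: in sieve terms the available level is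
`x = X^{1/deg g}` of the size `X` of the sifted integers, and everything above it is the conjecture.  Trivially
`T_g ≪_g x (log x)²`; the conjecture asks for `o(x)`.  (The `π`-level statement `BatemanHornAsymptotic ![g]` differs from the
`ψ`-form by prime powers and a partial summation; not treated here.)  No bearing on the truth of the conjecture.
-/

namespace Summit.Parity.BatemanHorn.Theorems

open Finset Filter ArithmeticFunction Asymptotics Polynomial
open scoped ArithmeticFunction.Moebius Topology
open Literature.NumberTheory.Sieve (polyRootCountMod IsBatemanHornSystem batemanHornConst
  card_filter_dvd_eval_eq_sum card_filter_dvd_eval_eq_polyRootCountMod abs_card_Ioc_filter_modEq_sub_le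
  exists_sum_rootCount_le)

/-! ### Elementary inputs -/

/-- **Root classes in `[1, x]`**: `|#{1 ≤ n ≤ x : d ∣ g(n)} - x·ρ_g(d)/d| ≤ ρ_g(d)` for `d ≥ 1`. -/
theorem abs_card_filter_dvd_eval_sub_le (g : ℤ[X]) {d : ℕ} (hd : 0 < d) (x : ℕ) :
    |(#((Icc 1 x).filter fun n : ℕ => (d : ℤ) ∣ g.eval (n : ℤ)) : ℝ)
      - (x : ℝ) * (polyRootCountMod ![g] d : ℝ) / d| ≤ polyRootCountMod ![g] d := by
  have hIcc : Icc 1 x = Ioc 0 x := by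
    ext n
    simp only [mem_Icc, mem_Ioc]
    omega
  rw [hIcc, card_filter_dvd_eval_eq_sum g _ hd, ← card_filter_dvd_eval_eq_polyRootCountMod g d]
  set T := (range d).filter (fun s : ℕ => (d : ℤ) ∣ g.eval (s : ℤ)) with hT
  have hrw : (x : ℝ) * ((#T : ℕ) : ℝ) / d = ∑ _s ∈ T, (x : ℝ) / d := by
    rw [sum_const, nsmul_eq_mul]
    ring
  rw [hrw, Nat.cast_sum, ← sum_sub_distrib]
  refine (abs_sum_le_sum_abs _ _).trans ?_
  calc ∑ s ∈ T, |(((#((Ioc 0 x).filter fun n : ℕ => n ≡ s [MOD d])) : ℕ) : ℝ) - (x : ℝ) / d|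
      ≤ ∑ _s ∈ T, (1 : ℝ) := sum_le_sum fun s _ => abs_card_Ioc_filter_modEq_sub_le hd x s
    _ = #T := by rw [sum_const, nsmul_eq_mul, mul_one]

/-- The divisors `d ≤ D` of `N ≠ 0` are the `d ∈ [1, D]` dividing `N`. -/
theorem divisors_filter_le_eq_Icc_filter {N : ℕ} (hN : N ≠ 0) (D : ℕ) :
    N.divisors.filter (fun d => d ≤ D) = (Icc 1 D).filter (fun d => d ∣ N) := by
  ext d
  simp only [mem_filter, Nat.mem_divisors, mem_Icc]
  constructor
  · rintro ⟨⟨hd, -⟩, hD⟩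
    exact ⟨⟨Nat.pos_of_dvd_of_pos hd (Nat.pos_of_ne_zero hN), hD⟩, hd⟩
  · rintro ⟨⟨-, hD⟩, hd⟩
    exact ⟨⟨hd, hN⟩, hD⟩

/-! ### The split of `ψ_g` at divisor size `D` -/

/-- **The divisor-size decomposition of `ψ_g(x) = ∑_{1 ≤ n ≤ x} Λ(|g(n)|)`** at level `D` (`g` without natural
roots): `ψ_g(x) = -∑_{d ≤ D} μ(d) log d · #{n ≤ x : d ∣ g(n)} - T_g(x; D)`. -/
theorem sum_vonMangoldt_polyVal_eq_split (g : ℤ[X]) (hg0 : ∀ n : ℕ, g.eval (n : ℤ) ≠ 0) (x D : ℕ) :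
    ∑ n ∈ Icc 1 x, Λ (g.eval (n : ℤ)).natAbs
      = -(∑ d ∈ Icc 1 D, (μ d : ℝ) * Real.log d
            * #((Icc 1 x).filter fun n : ℕ => (d : ℤ) ∣ g.eval (n : ℤ)))
        - ∑ n ∈ Icc 1 x,
            ∑ e ∈ ((g.eval (n : ℤ)).natAbs).divisors with D < (g.eval (n : ℤ)).natAbs / e,
              (μ ((g.eval (n : ℤ)).natAbs / e) : ℝ)
                * Real.log ((((g.eval (n : ℤ)).natAbs / e : ℕ)) : ℝ) := by
  have h1 : ∀ n ∈ Icc 1 x, Λ (g.eval (n : ℤ)).natAbs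
      = -(∑ d ∈ (Icc 1 D).filter (fun d : ℕ => (d : ℤ) ∣ g.eval (n : ℤ)), (μ d : ℝ) * Real.log d)
        - ∑ e ∈ ((g.eval (n : ℤ)).natAbs).divisors with D < (g.eval (n : ℤ)).natAbs / e,
            (μ ((g.eval (n : ℤ)).natAbs / e) : ℝ)
              * Real.log ((((g.eval (n : ℤ)).natAbs / e : ℕ)) : ℝ) := by
    intro n _
    have hN : (g.eval (n : ℤ)).natAbs ≠ 0 := Int.natAbs_ne_zero.mpr (hg0 n)
    have hset : (Icc 1 D).filter (fun d : ℕ => d ∣ (g.eval (n : ℤ)).natAbs)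
        = (Icc 1 D).filter (fun d : ℕ => (d : ℤ) ∣ g.eval (n : ℤ)) :=
      Finset.filter_congr fun d _ => Int.natCast_dvd.symm
    rw [vonMangoldt_eq_split _ D, divisors_filter_le_eq_Icc_filter hN, hset]
  rw [sum_congr rfl h1, sum_sub_distrib, sum_neg_distrib]
  congr 2
  simp_rw [sum_filter]
  rw [sum_comm]
  refine sum_congr rfl fun d _ => ?_
  rw [← sum_filter, sum_const, nsmul_eq_mul, mul_comm]

/-- The main term separated: `#{n ≤ x : d ∣ g(n)} = x ρ_g(d)/d + rem_g(x; d)` inside the small-divisor piece. -/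
theorem sum_moebius_log_card_eq (g : ℤ[X]) (x D : ℕ) :
    ∑ d ∈ Icc 1 D, (μ d : ℝ) * Real.log d * #((Icc 1 x).filter fun n : ℕ => (d : ℤ) ∣ g.eval (n : ℤ))
      = (x : ℝ) * ∑ d ∈ Icc 1 D, (μ d : ℝ) * Real.log d * (polyRootCountMod ![g] d : ℝ) / d
        + ∑ d ∈ Icc 1 D, (μ d : ℝ) * Real.log d
            * ((#((Icc 1 x).filter fun n : ℕ => (d : ℤ) ∣ g.eval (n : ℤ)) : ℝ)
                - (x : ℝ) * (polyRootCountMod ![g] d : ℝ) / d) := by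
  rw [mul_sum, ← sum_add_distrib]
  refine sum_congr rfl fun d _ => ?_
  ring

/-- The split, rearranged: `(ψ_g(x) - S x) + T_g(x; D) = x · (M_g(D) - S) - ∑_{d ≤ D} μ(d) log d · rem_g(x; d)`,
`M_g(D) = -∑_{d ≤ D} μ(d) log d ρ_g(d)/d`. -/
theorem sum_vonMangoldt_polyVal_sub_add_largeDivisorSum_eq (g : ℤ[X]) (hg0 : ∀ n : ℕ, g.eval (n : ℤ) ≠ 0)
    (x D : ℕ) (S : ℝ) :
    (∑ n ∈ Icc 1 x, Λ (g.eval (n : ℤ)).natAbs - S * x)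
      + ∑ n ∈ Icc 1 x,
          ∑ e ∈ ((g.eval (n : ℤ)).natAbs).divisors with D < (g.eval (n : ℤ)).natAbs / e,
            (μ ((g.eval (n : ℤ)).natAbs / e) : ℝ) * Real.log ((((g.eval (n : ℤ)).natAbs / e : ℕ)) : ℝ)
      = (x : ℝ) * ((-∑ d ∈ Icc 1 D, (μ d : ℝ) * Real.log d * (polyRootCountMod ![g] d : ℝ) / d) - S)
        - ∑ d ∈ Icc 1 D, (μ d : ℝ) * Real.log d
            * ((#((Icc 1 x).filter fun n : ℕ => (d : ℤ) ∣ g.eval (n : ℤ)) : ℝ)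
                - (x : ℝ) * (polyRootCountMod ![g] d : ℝ) / d) := by
  rw [sum_vonMangoldt_polyVal_eq_split g hg0 x D, sum_moebius_log_card_eq g x D]
  ring

/-! ### The small-divisor remainder at an arbitrary level -/

/-- `|∑_{d ≤ D} μ(d) log d · rem_g(x; d)| ≤ log D · (C D)` whenever `∑_{m ≤ y} ρ_g(m) ≤ C y` (`y ≥ 2`) and `D ≥ 2`. -/
theorem abs_sum_moebius_log_polyRem_le (g : ℤ[X]) {C : ℝ}
    (hC : ∀ y : ℝ, 2 ≤ y → ∑ m ∈ Icc 1 ⌊y⌋₊, (polyRootCountMod ![g] m : ℝ) ≤ C * y)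
    (x : ℕ) {D : ℕ} (hD : 2 ≤ D) :
    |∑ d ∈ Icc 1 D, (μ d : ℝ) * Real.log d
        * ((#((Icc 1 x).filter fun n : ℕ => (d : ℤ) ∣ g.eval (n : ℤ)) : ℝ)
            - (x : ℝ) * (polyRootCountMod ![g] d : ℝ) / d)| ≤ Real.log D * (C * D) := by
  have hsum : ∑ m ∈ Icc 1 D, (polyRootCountMod ![g] m : ℝ) ≤ C * D := by
    have h := hC D (by exact_mod_cast hD)
    rwa [Nat.floor_natCast] at h
  have hlogD0 : 0 ≤ Real.log (D : ℝ) := Real.log_natCast_nonneg D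
  calc |∑ d ∈ Icc 1 D, (μ d : ℝ) * Real.log d
          * ((#((Icc 1 x).filter fun n : ℕ => (d : ℤ) ∣ g.eval (n : ℤ)) : ℝ)
              - (x : ℝ) * (polyRootCountMod ![g] d : ℝ) / d)|
      ≤ ∑ d ∈ Icc 1 D, |(μ d : ℝ) * Real.log d
          * ((#((Icc 1 x).filter fun n : ℕ => (d : ℤ) ∣ g.eval (n : ℤ)) : ℝ)
              - (x : ℝ) * (polyRootCountMod ![g] d : ℝ) / d)| := abs_sum_le_sum_abs _ _
    _ ≤ ∑ d ∈ Icc 1 D, Real.log D * (polyRootCountMod ![g] d : ℝ) := by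
        refine sum_le_sum fun d hd => ?_
        have hd1 : 1 ≤ d := (mem_Icc.mp hd).1
        have hdD : d ≤ D := (mem_Icc.mp hd).2
        have hμ : |(μ d : ℝ)| ≤ 1 := by exact_mod_cast abs_moebius_le_one
        have hlog0 : 0 ≤ Real.log (d : ℝ) := Real.log_natCast_nonneg d
        have hlogD : Real.log (d : ℝ) ≤ Real.log D :=
          Real.log_le_log (by positivity) (by exact_mod_cast hdD)
        have hrem := abs_card_filter_dvd_eval_sub_le g (by omega : 0 < d) x
        rw [abs_mul, abs_mul, abs_of_nonneg hlog0]
        calc |(μ d : ℝ)| * Real.log d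
              * |((#((Icc 1 x).filter fun n : ℕ => (d : ℤ) ∣ g.eval (n : ℤ)) : ℝ)
                  - (x : ℝ) * (polyRootCountMod ![g] d : ℝ) / d)|
            ≤ 1 * Real.log D * (polyRootCountMod ![g] d : ℝ) :=
              mul_le_mul (mul_le_mul hμ hlogD hlog0 zero_le_one) hrem (abs_nonneg _) (by positivity)
          _ = Real.log D * (polyRootCountMod ![g] d : ℝ) := by ring
    _ = Real.log D * ∑ d ∈ Icc 1 D, (polyRootCountMod ![g] d : ℝ) := (mul_sum _ _ _).symm
    _ ≤ Real.log D * (C * D) := mul_le_mul_of_nonneg_left hsum hlogD0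

/-! ### The equivalence at an abstract admissible cut -/

/-- The error `x · (M_g(y(x)) - C(g)) - ∑_{d ≤ y(x)} μ(d) log d · rem_g(x; d)` is `o(x)` for every cut `y → ∞` with
`y log y = o(x)` — from `(R1)_g` (PROVED: `tendsto_neg_sum_moebius_rootCount_log_div`) and the first moment of `ρ_g`. -/
theorem polyMainError_isLittleO_of_cut {g : ℤ[X]} (hg : IsBatemanHornSystem ![g]) {y : ℕ → ℕ}
    (hy : Tendsto y atTop atTop)
    (hy' : (fun x : ℕ => Real.log (y x) * (y x : ℝ)) =o[atTop] fun x : ℕ => (x : ℝ)) :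
    (fun x : ℕ => (x : ℝ) * ((-∑ d ∈ Icc 1 (y x), (μ d : ℝ) * Real.log d * (polyRootCountMod ![g] d : ℝ) / d)
          - batemanHornConst ![g])
        - ∑ d ∈ Icc 1 (y x), (μ d : ℝ) * Real.log d
            * ((#((Icc 1 x).filter fun n : ℕ => (d : ℤ) ∣ g.eval (n : ℤ)) : ℝ)
                - (x : ℝ) * (polyRootCountMod ![g] d : ℝ) / d))
      =o[atTop] fun x : ℕ => (x : ℝ) := by
  have hirr : Irreducible g := by simpa using hg.irreducible 0
  have hdeg : 0 < g.natDegree := by simpa using hg.natDegree_pos 0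
  obtain ⟨C, hC0, hC⟩ := exists_sum_rootCount_le hirr hdeg
  have hR1 := tendsto_neg_sum_moebius_rootCount_log_div hg
  rw [isLittleO_iff]
  intro c hc
  have h1 : ∀ᶠ x : ℕ in atTop,
      |(-∑ d ∈ Icc 1 (y x), (μ d : ℝ) * Real.log d * (polyRootCountMod ![g] d : ℝ) / d)
        - batemanHornConst ![g]| ≤ c / 2 := by
    have hev := hy.eventually (Metric.tendsto_nhds.mp hR1 (c / 2) (by positivity))
    filter_upwards [hev] with x hx
    rw [Real.dist_eq] at hx
    exact hx.le
  have h2 : ∀ᶠ x : ℕ in atTop, Real.log (y x) * (C * (y x : ℝ)) ≤ c / 2 * x := by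
    have h := hy'.bound (show (0 : ℝ) < c / 2 / C by positivity)
    filter_upwards [h] with x hx
    rw [Real.norm_eq_abs, Real.norm_eq_abs,
      abs_of_nonneg (mul_nonneg (Real.log_natCast_nonneg _) (Nat.cast_nonneg _)),
      abs_of_nonneg (Nat.cast_nonneg x)] at hx
    calc Real.log (y x) * (C * (y x : ℝ)) = C * (Real.log (y x) * (y x : ℝ)) := by ring
      _ ≤ C * (c / 2 / C * x) := mul_le_mul_of_nonneg_left hx hC0.le
      _ = c / 2 * x := by field_simp
  filter_upwards [h1, h2, hy.eventually_ge_atTop 2, eventually_ge_atTop 1] with x hx1 hx2 hy2 hx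
  have hx0 : (0 : ℝ) ≤ x := by positivity
  have hrem : |∑ d ∈ Icc 1 (y x), (μ d : ℝ) * Real.log d
      * ((#((Icc 1 x).filter fun n : ℕ => (d : ℤ) ∣ g.eval (n : ℤ)) : ℝ)
          - (x : ℝ) * (polyRootCountMod ![g] d : ℝ) / d)| ≤ c / 2 * x :=
    (abs_sum_moebius_log_polyRem_le g hC x hy2).trans hx2
  have hmain : |(x : ℝ) * ((-∑ d ∈ Icc 1 (y x), (μ d : ℝ) * Real.log d * (polyRootCountMod ![g] d : ℝ) / d)
      - batemanHornConst ![g])| ≤ x * (c / 2) := by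
    rw [abs_mul, abs_of_nonneg hx0]
    exact mul_le_mul_of_nonneg_left hx1 hx0
  simp only [Real.norm_eq_abs]
  rw [abs_of_nonneg hx0]
  calc _ ≤ |(x : ℝ) * ((-∑ d ∈ Icc 1 (y x), (μ d : ℝ) * Real.log d * (polyRootCountMod ![g] d : ℝ) / d)
            - batemanHornConst ![g])|
          + |∑ d ∈ Icc 1 (y x), (μ d : ℝ) * Real.log d
              * ((#((Icc 1 x).filter fun n : ℕ => (d : ℤ) ∣ g.eval (n : ℤ)) : ℝ)
                  - (x : ℝ) * (polyRootCountMod ![g] d : ℝ) / d)| := abs_sub _ _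
    _ ≤ x * (c / 2) + c / 2 * x := add_le_add hmain hrem
    _ = c * x := by ring

/-- **`ψ_g(x) ~ C(g) x ⟺ T_g(x; y(x)) = o(x)` for every one-polynomial Bateman–Horn system `g` and every admissible
cut** `y → ∞`, `y log y = o(x)` (`g` without natural roots; see the next theorem for `deg g ≥ 2`). -/
theorem isEquivalent_sum_vonMangoldt_polyVal_iff_largeDivisorSum_isLittleO_of_cut {g : ℤ[X]}
    (hg : IsBatemanHornSystem ![g]) (hg0 : ∀ n : ℕ, g.eval (n : ℤ) ≠ 0) {y : ℕ → ℕ}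
    (hy : Tendsto y atTop atTop)
    (hy' : (fun x : ℕ => Real.log (y x) * (y x : ℝ)) =o[atTop] fun x : ℕ => (x : ℝ)) :
    ((fun x : ℕ => ∑ n ∈ Icc 1 x, Λ (g.eval (n : ℤ)).natAbs) ~[atTop]
        fun x : ℕ => batemanHornConst ![g] * (x : ℝ))
      ↔ (fun x : ℕ => ∑ n ∈ Icc 1 x,
            ∑ e ∈ ((g.eval (n : ℤ)).natAbs).divisors with y x < (g.eval (n : ℤ)).natAbs / e,
              (μ ((g.eval (n : ℤ)).natAbs / e) : ℝ) * Real.log ((((g.eval (n : ℤ)).natAbs / e : ℕ)) : ℝ))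
          =o[atTop] fun x : ℕ => (x : ℝ) := by
  have hS : batemanHornConst ![g] ≠ 0 :=
    (Literature.NumberTheory.Sieve.IsBatemanHornSystem.hasBatemanHornConst_holds hg).2.ne'
  have hE := polyMainError_isLittleO_of_cut hg hy hy'
  have hid : ((fun x : ℕ => ∑ n ∈ Icc 1 x, Λ (g.eval (n : ℤ)).natAbs)
        - fun x : ℕ => batemanHornConst ![g] * (x : ℝ))
      = fun x : ℕ =>
        ((x : ℝ) * ((-∑ d ∈ Icc 1 (y x), (μ d : ℝ) * Real.log d * (polyRootCountMod ![g] d : ℝ) / d)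
            - batemanHornConst ![g])
          - ∑ d ∈ Icc 1 (y x), (μ d : ℝ) * Real.log d
              * ((#((Icc 1 x).filter fun n : ℕ => (d : ℤ) ∣ g.eval (n : ℤ)) : ℝ)
                  - (x : ℝ) * (polyRootCountMod ![g] d : ℝ) / d))
        - ∑ n ∈ Icc 1 x,
            ∑ e ∈ ((g.eval (n : ℤ)).natAbs).divisors with y x < (g.eval (n : ℤ)).natAbs / e,
              (μ ((g.eval (n : ℤ)).natAbs / e) : ℝ) * Real.log ((((g.eval (n : ℤ)).natAbs / e : ℕ)) : ℝ) := by
    funext x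
    have h := sum_vonMangoldt_polyVal_sub_add_largeDivisorSum_eq g hg0 x (y x) (batemanHornConst ![g])
    simp only [Pi.sub_apply]
    linarith
  show ((fun x : ℕ => ∑ n ∈ Icc 1 x, Λ (g.eval (n : ℤ)).natAbs)
        - fun x : ℕ => batemanHornConst ![g] * (x : ℝ))
      =o[atTop] (fun x : ℕ => batemanHornConst ![g] * (x : ℝ)) ↔ _
  rw [isLittleO_const_mul_right_iff hS, hid]
  constructor
  · intro h
    exact (hE.sub h).congr_left fun x => by ring
  · intro hT
    exact hE.sub hT

/-- The same for `deg g ≥ 2`, where `g` has no integer root. -/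
theorem isEquivalent_sum_vonMangoldt_polyVal_iff_largeDivisorSum_isLittleO_of_cut' {g : ℤ[X]}
    (hg : IsBatemanHornSystem ![g]) (hdeg : 2 ≤ g.natDegree) {y : ℕ → ℕ}
    (hy : Tendsto y atTop atTop)
    (hy' : (fun x : ℕ => Real.log (y x) * (y x : ℝ)) =o[atTop] fun x : ℕ => (x : ℝ)) :
    ((fun x : ℕ => ∑ n ∈ Icc 1 x, Λ (g.eval (n : ℤ)).natAbs) ~[atTop]
        fun x : ℕ => batemanHornConst ![g] * (x : ℝ))
      ↔ (fun x : ℕ => ∑ n ∈ Icc 1 x,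
            ∑ e ∈ ((g.eval (n : ℤ)).natAbs).divisors with y x < (g.eval (n : ℤ)).natAbs / e,
              (μ ((g.eval (n : ℤ)).natAbs / e) : ℝ) * Real.log ((((g.eval (n : ℤ)).natAbs / e : ℕ)) : ℝ))
          =o[atTop] fun x : ℕ => (x : ℝ) := by
  -- an irreducible `g` of degree `≥ 2` has no integer root (else `X - C n ∣ g` with a unit cofactor)
  have hirr : Irreducible g := by simpa using hg.irreducible 0
  have hg0 : ∀ n : ℕ, g.eval (n : ℤ) ≠ 0 := by
    intro n h
    obtain ⟨q, hq⟩ := dvd_iff_isRoot.mpr (IsRoot.def.mpr h)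
    rcases hirr.isUnit_or_isUnit hq with hu | hu
    · have h1 := natDegree_eq_zero_of_isUnit hu
      rw [natDegree_X_sub_C] at h1
      exact one_ne_zero h1
    · have h1 : g.natDegree = 1 := by
        rw [hq, natDegree_mul (X_sub_C_ne_zero (n : ℤ)) hu.ne_zero, natDegree_X_sub_C,
          natDegree_eq_zero_of_isUnit hu]
      omega
  exact isEquivalent_sum_vonMangoldt_polyVal_iff_largeDivisorSum_isLittleO_of_cut hg hg0 hy hy'

/-! ### The two standard cuts: `⌊x^{1-ε}⌋` and `⌊x/(log x)^A⌋` -/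

/-- `y log y = o(x)` for `y = ⌊x^{1-ε}⌋`, `0 < ε` (indeed `≤ x^{1-ε} log x`). -/
theorem rpowCut_mul_log_isLittleO {ε : ℝ} (hε : 0 < ε) (hε1 : ε < 1) :
    (fun x : ℕ => Real.log (⌊(x : ℝ) ^ (1 - ε)⌋₊ : ℕ) * ((⌊(x : ℝ) ^ (1 - ε)⌋₊ : ℕ) : ℝ))
      =o[atTop] fun x : ℕ => (x : ℝ) := by
  have hlog : (fun t : ℝ => Real.log t) =o[atTop] fun t : ℝ => t ^ ε := isLittleO_log_rpow_atTop hε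
  have hlogN : (fun x : ℕ => Real.log (x : ℝ)) =o[atTop] fun x : ℕ => (x : ℝ) ^ ε :=
    hlog.comp_tendsto tendsto_natCast_atTop_atTop
  rw [isLittleO_iff]
  intro c hc
  filter_upwards [hlogN.bound hc, eventually_ge_atTop 1] with x hx hx1
  have hX1 : (1 : ℝ) ≤ x := by exact_mod_cast hx1
  have hX0 : (0 : ℝ) < x := by linarith
  have hl0 : 0 ≤ Real.log (x : ℝ) := Real.log_nonneg hX1
  rw [Real.norm_eq_abs, Real.norm_eq_abs, abs_of_nonneg hl0,
    abs_of_pos (Real.rpow_pos_of_pos hX0 _)] at hx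
  set Y : ℕ := ⌊(x : ℝ) ^ (1 - ε)⌋₊ with hY
  have hYle : (Y : ℝ) ≤ (x : ℝ) ^ (1 - ε) := Nat.floor_le (by positivity)
  have hYx : (Y : ℝ) ≤ x := by
    refine hYle.trans ?_
    calc (x : ℝ) ^ (1 - ε) ≤ (x : ℝ) ^ (1 : ℝ) := Real.rpow_le_rpow_of_exponent_le hX1 (by linarith)
      _ = x := Real.rpow_one _
  have hlogY : Real.log (Y : ℝ) ≤ Real.log x := by
    rcases Nat.eq_zero_or_pos Y with hY0 | hY0
    · rw [hY0, Nat.cast_zero, Real.log_zero]; exact hl0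
    · exact Real.log_le_log (by exact_mod_cast hY0) hYx
  have hlogY0 : 0 ≤ Real.log (Y : ℝ) := Real.log_natCast_nonneg Y
  rw [Real.norm_eq_abs, Real.norm_eq_abs, abs_of_nonneg (mul_nonneg hlogY0 (Nat.cast_nonneg Y)),
    abs_of_pos hX0]
  calc Real.log (Y : ℝ) * (Y : ℝ) ≤ Real.log x * (x : ℝ) ^ (1 - ε) :=
        mul_le_mul hlogY hYle (Nat.cast_nonneg Y) hl0
    _ ≤ (c * (x : ℝ) ^ ε) * (x : ℝ) ^ (1 - ε) := mul_le_mul_of_nonneg_right hx (by positivity)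
    _ = c * x := by
        rw [mul_assoc, ← Real.rpow_add hX0]
        norm_num

/-- **`ψ_g(x) ~ C(g) x ⟺ ∑_{n ≤ x} ∑_{d ∣ |g(n)|, d > x^{1-ε}} μ(d) log d = o(x)`** (`0 < ε < 1`, `deg g ≥ 2`). -/
theorem isEquivalent_sum_vonMangoldt_polyVal_iff_largeDivisorSum_isLittleO {g : ℤ[X]}
    (hg : IsBatemanHornSystem ![g]) (hdeg : 2 ≤ g.natDegree) {ε : ℝ} (hε : 0 < ε) (hε1 : ε < 1) :
    ((fun x : ℕ => ∑ n ∈ Icc 1 x, Λ (g.eval (n : ℤ)).natAbs) ~[atTop]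
        fun x : ℕ => batemanHornConst ![g] * (x : ℝ))
      ↔ (fun x : ℕ => ∑ n ∈ Icc 1 x,
            ∑ e ∈ ((g.eval (n : ℤ)).natAbs).divisors with ⌊(x : ℝ) ^ (1 - ε)⌋₊ < (g.eval (n : ℤ)).natAbs / e,
              (μ ((g.eval (n : ℤ)).natAbs / e) : ℝ) * Real.log ((((g.eval (n : ℤ)).natAbs / e : ℕ)) : ℝ))
          =o[atTop] fun x : ℕ => (x : ℝ) :=
  isEquivalent_sum_vonMangoldt_polyVal_iff_largeDivisorSum_isLittleO_of_cut' hg hdeg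
    (tendsto_floor_rpow_atTop (by linarith)) (rpowCut_mul_log_isLittleO hε hε1)

/-- **`ψ_g(x) ~ C(g) x ⟺ ∑_{n ≤ x} ∑_{d ∣ |g(n)|, d > x/(log x)^A} μ(d) log d = o(x)`** (`A > 1`, `deg g ≥ 2`): the
`ψ`-form of Bateman–Horn for `g` lives in the divisors of `|g(n)| ≍ x^{deg g}` within a power of `log x` below `x`
and above. -/
theorem isEquivalent_sum_vonMangoldt_polyVal_iff_largeDivisorSum_isLittleO_logPowCut {g : ℤ[X]}
    (hg : IsBatemanHornSystem ![g]) (hdeg : 2 ≤ g.natDegree) {A : ℝ} (hA : 1 < A) :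
    ((fun x : ℕ => ∑ n ∈ Icc 1 x, Λ (g.eval (n : ℤ)).natAbs) ~[atTop]
        fun x : ℕ => batemanHornConst ![g] * (x : ℝ))
      ↔ (fun x : ℕ => ∑ n ∈ Icc 1 x,
            ∑ e ∈ ((g.eval (n : ℤ)).natAbs).divisors with
                ⌊(x : ℝ) / Real.log x ^ A⌋₊ < (g.eval (n : ℤ)).natAbs / e,
              (μ ((g.eval (n : ℤ)).natAbs / e) : ℝ) * Real.log ((((g.eval (n : ℤ)).natAbs / e : ℕ)) : ℝ))
          =o[atTop] fun x : ℕ => (x : ℝ) :=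
  isEquivalent_sum_vonMangoldt_polyVal_iff_largeDivisorSum_isLittleO_of_cut' hg hdeg
    (tendsto_logPowCut_atTop (by linarith)) (logPowCut_mul_log_isLittleO hA)

end Summit.Parity.BatemanHorn.Theorems
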